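import Summits.QuantumFields.BalabanUV.T4Continuum.Support.NE3CovariantLineAdjointFrame
import Summits.QuantumFields.BalabanUV.T4Continuum.Support.NE3CovariantBlockDivergence
import HarnessLib

/-!
# NE7CombLineSumDivergence — (β_S) OF THE ENERGY ROAD: THE κ-LAST COMB LINE SUM OF A COVARIANT DIVERGENCE IS A BOUNDARY FLUX UP TO THIN
# LOOPS — `‖TWg M (combFrame W M) T̃ (z,κ)‖ ≤ 2d·M^d·b·(1 + (d+1)(M−1)·M·a)` for the framed-back datum `T̃(y,ν) = Ad_{W(y,ν)}⁻¹ Σ_μ ∇_μ^† B_{μν}(y)`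
# of ANY site-framed two-index field `B` with `‖B‖ ≤ b`, at a unitary background with `‖W(∂p) − 1‖ ≤ a` (instead of the naive `2d·M^{d+1}·b`)

Cell `pub-balaban`, rung (B)+1 sub-cell t4, lineage `b2b-balaban-t4-ne7-p1`, generation 63 (CRUX PROVER NE7 #1, ruling e34b3e0c (2)); hunt (h7)
«ENERGY ROAD», memo v2 §5–§6 (`t4/b2b-balaban-t4-ne7-p1-g62/HUNT-H7-ENERGY-ROAD-v2.md`): in the exact-current form of (E3)
(`NE7TensionKernelCoercivity.normSq_le_of_exact_annihilator`, `‖T‖² ≤ 4‖ST̃‖²∕λ + (4Λ²∕λ+2)θ₀²`) the term `‖S T̃‖` must gain a factor `M = L^k` over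
the trivial bound: «the block-line average of a covariant divergence telescopes transversally to boundary fluxes».  With `S` = the NE3 swarm's
comb line sum of record `TWg M (combFrame W M)` (K4-a `NE3CovariantLineAdjoint{,Frame}`; its (α_S) is this generation's `NE7CombLineSumGramBounds`),
THIS FILE proves that statement at a CURVED small-field background.  For the tension `T_ν = Σ_μ cDstar W μ B_{·μν}` (`NE3CovariantCalculus.cDstar`,
site frames) and its right-trivialised datum `T̃(y,ν) = Ad_{W(y,ν)}⁻¹ T_ν(y)` (the `resF` datum of `NE7TensionKernelCoercivity`), the comb line sum
reads `Σ_{v∈[0,M)^d} Σ_{i<M} Ad_{W(q; comb(v,i))} T_κ(q+v+i e_κ)` (§4 `TWg_combFrame_framed_eq`; the copy's own bond cancels the framing).  For each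
`μ` the block sum over `v` of `Ad_{comb} (cDstar_μ g)` is a telescoping sum in the coordinate `v_μ` (K4-c's `sum_periodBox_telescope`) up to the
DEFECTS `(Ad_{W(q;comb(v+e_μ,i))·W(y,μ)⁻¹} − Ad_{W(q;comb(v,i))}) g(y)`, i.e. conjugations by the THIN LOOPS `comb(v,i) · (y,μ) · comb(v+e_μ,i)⁻¹`
(§2): such a loop is the `W`-LADDER over the `κ`-run `seg κ (v_κ+i)` (B7's `ladder_bound` BY NAME: `≤ (v_κ+i)·a`) times ONE comb-gauge bond at the
transverse base point (C0 `NE3CombGauge.norm_comb_sub_one_le_single`: `≤ (d−1)(M−1)·a`), so **`norm_combStep_loop_sub_one_le`**: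
`‖W(loop) − 1‖ ≤ (v_κ + i + (d−1)(M−1))·a` — FIRST order in `M·a`, not `(M·a)²`-free-but-`M²a` (the uniform loop lemma's `|Γ|²a` would lose the factor
`M`); for `μ = κ` the loop is trivial (`combTransport_add_e_self`).  Hence §3 **`norm_sum_Ad_combTransport_cDstar_le`**: for `‖g‖ ≤ b`, `i < M`,
`‖Σ_{v∈[0,M)^d} Ad_{comb(v,i)} (cDstar W μ g)(q+v+ie_κ)‖ ≤ 2·M^{d−1}·b + 2(d+1)(M−1)·M^d·a·b` (two `μ`-faces of `M^{d−1}` sites, `M^d` defects), and §4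
**`norm_TWg_combFrame_tension_le`**: `‖TWg M (combFrame W M) T̃ z κ‖ ≤ 2d·M^d·b·(1 + (d+1)(M−1)·M·a)`, §5 its `ℓ²(torus)` form
**`sum_nhsNormSq_TWg_combFrame_tension_le`**: `Σ_{z∈periodBox N}Σ_κ nhsNormSq (…) ≤ N^d·d·(2d·M^d·b·(1+(d+1)(M−1)Ma))²`.  ARITHMETIC of the road
(memo v2 §6): with `λ = M^d(M²+2)∕3` (this generation's Gram bound), `b ≍ a = ε·M^{−2}`: `‖ST̃‖²∕λ ≲ 12d³(1+(d+1)ε)²·ε²·N^d·M^d·M^{−6}` — the TARGET ORDER of (H∃)ᵀ.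
WHAT REMAINS for (E3″): the perturbation `‖QbarIter k W − M^{−d}•TWc‖` (NE3 C1 tower files), the identification (h7-e), (8) interiority.
HONEST FRAMING (page 1): lattice bookkeeping + B7's non-abelian Stokes ladder on OUR typed objects at ONE unitary small-field background; nothing about
Bałaban's minimisers; NE7, NE3 NOT PRINTED in [Balaban1984PropagatorsI]–[Balaban1989LargeFieldII] and NOT PROVED; FIXED FINITE torus, rung (B)+1;
continuum YM on T⁴ ⇐ BetaPertH ∧ nine spine estimates (0/9 proved); BetaPertH ⇐ (D1) ∧ (D4) ∧ CAP+tail; G-an2-4 gates asym, D1 and NE2/3/4; NOT infinite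
volume, NOT mass gap, NOT Clay.  0 def, 0 sorry.
-/

set_option autoImplicit false

open scoped BigOperators Matrix Matrix.Norms.L2Operator
open Finset

namespace Summit.QuantumFields.BalabanUV.T4Continuum.NE7CombLineSumDivergence

open Literature.MathematicalPhysics.QuantumFieldTheory.Balaban1983to89
open B7Prop1Explicit B7Prop2Explicit MatrixNorms UnitaryModel
open T4AveragingDeficitWall (IsUnitaryCfg SmallField Ad)
open T4AveragingDeficitWallBoundary (periodBox mem_periodBox card_periodBox)
open T4AveragingDeficitNonAbelian (Ad_mul Ad_sub)
open AveragingDeficitNearIdentity (Ad_one Ad_sum)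
open AveragingDeficitTransport (norm_Ad_of_unitary mem_U1_of_unitary)
open AveragingDeficitBlockDensity (btree norm_Ad_sub_Ad_le_of_le)
open NE3CombGauge (norm_comb_sub_one_le_single)
open NE3CovariantCalculus (cDstar)
open NE3StraightAverageAdjoint (tbase)
open NE3CovariantBlockDivergence (sum_periodBox_telescope)
open NE3CovariantLineAdjoint

noncomputable section

variable {d : ℕ} {n : Type*} [Fintype n] [DecidableEq n]

/-! ## §1 Comb words of μ-neighbours -/

omit [Fintype n] [DecidableEq n] in
/-- The κ-last comb word to the `κ`-NEIGHBOUR of a copy is the same transverse tree and one more `κ`-step: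
`klastWord κ (v + e_κ) i = klastWord κ v (i+1)`. [folklore] -/
theorem klastWord_add_e_self (κ : Fin d) (v : Site d) (i : ℕ) : klastWord κ (v + e κ) i = klastWord κ v (i + 1) := by
  unfold klastWord
  have h1 : (v + e κ) κ = v κ + 1 := by
    simp only [Pi.add_apply, e_apply, if_true]
  have h2 : (v + e κ) - (v + e κ) κ • e κ = v - v κ • e κ := by
    rw [h1, add_smul, one_smul]
    abel
  rw [h2, h1]
  congr 2
  push_cast
  ring

omit [Fintype n] [DecidableEq n] in
/-- The κ-last comb word to a TRANSVERSE neighbour (`μ ≠ κ`): the transverse tree to `t + e_μ`, then the same `κ`-run. [folklore] -/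
theorem klastWord_add_e_of_ne (κ : Fin d) {μ : Fin d} (hμ : μ ≠ κ) (v : Site d) (i : ℕ) :
    klastWord κ (v + e μ) i = treeWord (v - v κ • e κ + e μ) ++ seg κ (v κ + (i : ℤ)) := by
  unfold klastWord
  have h1 : (v + e μ) κ = v κ := by
    simp only [Pi.add_apply, e_apply, if_neg hμ.symm, add_zero]
  rw [h1, show v + e μ - v κ • e κ = v - v κ • e κ + e μ by abel]

/-- **THE κ-NEIGHBOUR'S TRANSPORT IS ONE MORE BOND**: `combTransport W M z κ (v + e_κ) i = combTransport W M z κ v i · W(M•z+v+i•e_κ, κ)`. [folklore] -/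
theorem combTransport_add_e_self (W : Site d → Fin d → (Matrix n n ℂ)ˣ) (M : ℕ) (z : Site d) (κ : Fin d) (v : Site d) (i : ℕ) :
    combTransport W M z κ (v + e κ) i = combTransport W M z κ v i * W ((M : ℤ) • z + v + (i : ℤ) • e κ) κ := by
  rw [← combTransport_succ]
  unfold combTransport
  rw [klastWord_add_e_self]

/-! ## §2 The thin loop between the comb transports of μ-neighbouring copies -/

omit [Fintype n] [DecidableEq n] in
/-- The transverse part `t = v − v_κ e_κ` of an offset `v ∈ [0,M)^d` lies in `[0, M−1]^d`. [folklore] -/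
theorem transverse_mem {M : ℕ} {v : Site d} (hv : v ∈ periodBox (d := d) M) (κ j : Fin d) :
    0 ≤ (v - v κ • e κ) j ∧ (v - v κ • e κ) j ≤ (M : ℤ) - 1 := by
  have h := (mem_periodBox.mp hv) j
  have hκ := (mem_periodBox.mp hv) κ
  by_cases hj : j = κ
  · subst hj
    simp only [Pi.sub_apply, Pi.smul_apply, e_apply, if_true, smul_eq_mul, mul_one, sub_self]
    exact ⟨le_rfl, by omega⟩
  · simp only [Pi.sub_apply, Pi.smul_apply, e_apply, if_neg hj, smul_eq_mul, mul_zero, sub_zero]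
    exact ⟨h.1, by omega⟩

/-- **THE THIN LOOP IS FIRST ORDER IN `M·a`**: for unitary `W` with `‖W(∂p) − 1‖ ≤ a`, `v ∈ [0,M)^d`, any `i`, any `μ` (with `y = M•z+v+i•e_κ`):
`‖combTransport W M z κ v i · W(y,μ) · (combTransport W M z κ (v+e_μ) i)⁻¹ − 1‖ ≤ (v_κ + i + (d−1)(M−1))·a` — for `μ ≠ κ` the loop is the `W`-ladder
over the `κ`-run `seg κ (v_κ+i)` at the transverse base point `M•z+t` (B7 `ladder_bound`: `≤ (v_κ+i)·a`) times the comb-gauge bond `(M•z+t, μ)`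
(C0 `norm_comb_sub_one_le_single`: `≤ (d−1)(M−1)·a`), conjugated by the tree transport; for `μ = κ` it is trivial. [folklore] -/
theorem norm_combStep_loop_sub_one_le [Nonempty n] {M : ℕ} (hM : 1 ≤ M) {W : Site d → Fin d → (Matrix n n ℂ)ˣ} (hW : IsUnitaryCfg W)
    {a : ℝ} (ha : 0 ≤ a) (hWa : SmallField W a) (z : Site d) (κ μ : Fin d) {v : Site d} (hv : v ∈ periodBox (d := d) M) (i : ℕ) :
    ‖((combTransport W M z κ v i * W ((M : ℤ) • z + v + (i : ℤ) • e κ) μ * (combTransport W M z κ (v + e μ) i)⁻¹ : (Matrix n n ℂ)ˣ) :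
        Matrix n n ℂ) - 1‖ ≤ (((v κ : ℤ) : ℝ) + i + ((d : ℝ) - 1) * ((M : ℝ) - 1)) * a := by
  have hd : (1 : ℝ) ≤ d := by exact_mod_cast Nat.succ_le_of_lt (Fin.pos κ)
  have hM1 : (1 : ℝ) ≤ M := by exact_mod_cast hM
  have hvκ : (0 : ℝ) ≤ ((v κ : ℤ) : ℝ) := by exact_mod_cast ((mem_periodBox.mp hv) κ).1
  have hbound0 : 0 ≤ (((v κ : ℤ) : ℝ) + i + ((d : ℝ) - 1) * ((M : ℝ) - 1)) * a := by
    have : (0 : ℝ) ≤ ((d : ℝ) - 1) * ((M : ℝ) - 1) := mul_nonneg (by linarith) (by linarith)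
    positivity
  by_cases hμ : μ = κ
  · subst hμ
    rw [combTransport_add_e_self, mul_inv_cancel, Units.val_one, sub_self, norm_zero]
    exact hbound0
  -- `μ ≠ κ`: the ladder over the `κ`-run times one comb bond
  set q : Site d := (M : ℤ) • z with hq
  set t : Site d := v - v κ • e κ with ht
  set s : ℤ := v κ + (i : ℤ) with hs
  have hU1 : ∀ x ν, W x ν ∈ U1 (Matrix n n ℂ) := fun x ν => mem_U1_of_unitary (hW x ν)
  have hkv : klastWord κ v i = treeWord t ++ seg κ s := rfl
  have hkv' : klastWord κ (v + e μ) i = treeWord (t + e μ) ++ seg κ s := klastWord_add_e_of_ne κ hμ v i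
  have hy : q + v + (i : ℤ) • e κ = q + t + s • e κ := by
    rw [ht, hs, add_smul]
    abel
  -- the four transports
  have hT : combTransport W M z κ v i = hol W q (treeWord t) * hol W (q + t) (seg κ s) := by
    unfold combTransport; rw [hkv, hol_append, disp_treeWord]
  have hT' : combTransport W M z κ (v + e μ) i = hol W q (treeWord (t + e μ)) * hol W (q + t + e μ) (seg κ s) := by
    unfold combTransport; rw [hkv', hol_append, disp_treeWord, add_assoc]
  have hlad : hol W (q + t) (ladder (seg κ s) μ)
      = hol W (q + t) (seg κ s) * W (q + t + s • e κ) μ * (hol W (q + t + e μ) (seg κ s))⁻¹ * (W (q + t) μ)⁻¹ := by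
    rw [hol_ladder, disp_seg]
  have hcomb : gaugeAct (btree M W z) W (q + t) μ = hol W q (treeWord t) * W (q + t) μ * (hol W q (treeWord (t + e μ)))⁻¹ := by
    unfold gaugeAct btree
    rw [← hq, show q + t - q = t by abel, show q + t + e μ - q = t + e μ by abel]
  -- the loop as (tree-conjugated ladder) · (comb bond)
  have hL : combTransport W M z κ v i * W (q + v + (i : ℤ) • e κ) μ * (combTransport W M z κ (v + e μ) i)⁻¹
      = hol W q (treeWord t) * hol W (q + t) (ladder (seg κ s) μ) * (hol W q (treeWord t))⁻¹ * gaugeAct (btree M W z) W (q + t) μ := by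
    rw [hT, hT', hy, hlad, hcomb]
    group
  rw [hL, Units.val_mul]
  have hBt : hol W q (treeWord t) ∈ U1 (Matrix n n ℂ) := hol_mem hU1 _ _
  have hΛ : hol W (q + t) (ladder (seg κ s) μ) ∈ U1 (Matrix n n ℂ) := hol_mem hU1 _ _
  have hX : hol W q (treeWord t) * hol W (q + t) (ladder (seg κ s) μ) * (hol W q (treeWord t))⁻¹ ∈ U1 (Matrix n n ℂ) :=
    (U1 _).mul_mem ((U1 _).mul_mem hBt hΛ) ((U1 _).inv_mem hBt)
  -- the ladder bound and the comb bond bound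
  have h1 : ‖((hol W q (treeWord t) * hol W (q + t) (ladder (seg κ s) μ) * (hol W q (treeWord t))⁻¹ : (Matrix n n ℂ)ˣ) : Matrix n n ℂ) - 1‖
      ≤ (s : ℝ) * a := by
    rw [Units.val_mul, Units.val_mul]
    refine (norm_units_conj_sub_one_le hBt _).trans ?_
    have h := ladder_bound W hU1 μ (fun x l hl => norm_hol_lplaqWord_sub_one_le W hU1 hWa x l μ hl) (seg κ s) (q + t)
      (fun l hl => by rw [mem_seg hl]; exact fun h => hμ h.symm)
    rw [length_seg] at h
    have hs0 : 0 ≤ s := by rw [hs]; have := ((mem_periodBox.mp hv) κ).1; positivity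
    have e1 : ((s.natAbs : ℕ) : ℝ) = (s : ℝ) := by
      rw [Nat.cast_natAbs, Int.cast_abs, abs_of_nonneg (by exact_mod_cast hs0)]
    rw [e1] at h
    exact h
  have h2 : ‖((gaugeAct (btree M W z) W (q + t) μ : (Matrix n n ℂ)ˣ) : Matrix n n ℂ) - 1‖ ≤ ((d : ℝ) - 1) * ((M : ℝ) - 1) * a := by
    refine norm_comb_sub_one_le_single hW hWa ha z (x := q + t) (fun j => ?_) (fun j => ?_) μ
    · have h := (transverse_mem hv κ j).1
      simp only [hq, ht, Pi.add_apply] at h ⊢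
      linarith
    · have h := (transverse_mem hv κ j).2
      simp only [hq, ht, Pi.add_apply] at h ⊢
      linarith
  calc ‖((hol W q (treeWord t) * hol W (q + t) (ladder (seg κ s) μ) * (hol W q (treeWord t))⁻¹ : (Matrix n n ℂ)ˣ) : Matrix n n ℂ)
          * ((gaugeAct (btree M W z) W (q + t) μ : (Matrix n n ℂ)ˣ) : Matrix n n ℂ) - 1‖
      ≤ ‖((hol W q (treeWord t) * hol W (q + t) (ladder (seg κ s) μ) * (hol W q (treeWord t))⁻¹ : (Matrix n n ℂ)ˣ) : Matrix n n ℂ) - 1‖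
          + ‖((gaugeAct (btree M W z) W (q + t) μ : (Matrix n n ℂ)ˣ) : Matrix n n ℂ) - 1‖ :=
        B8Ineq170.norm_mul_sub_one_le_of_norm_le_one (mem_U1.mp hX).1
    _ ≤ (s : ℝ) * a + ((d : ℝ) - 1) * ((M : ℝ) - 1) * a := add_le_add h1 h2
    _ = (((v κ : ℤ) : ℝ) + i + ((d : ℝ) - 1) * ((M : ℝ) - 1)) * a := by rw [hs]; push_cast; ring

/-- **THE DEFECT OF ONE TELESCOPING STEP**: `‖Ad_{comb(v+e_μ,i)·W(y,μ)⁻¹} X − Ad_{comb(v,i)} X‖ ≤ 2·(v_κ + i + (d−1)(M−1))·a·‖X‖`. [folklore] -/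
theorem norm_Ad_combStep_sub_le [Nonempty n] {M : ℕ} (hM : 1 ≤ M) {W : Site d → Fin d → (Matrix n n ℂ)ˣ} (hW : IsUnitaryCfg W)
    {a : ℝ} (ha : 0 ≤ a) (hWa : SmallField W a) (z : Site d) (κ μ : Fin d) {v : Site d} (hv : v ∈ periodBox (d := d) M) (i : ℕ)
    (X : Matrix n n ℂ) :
    ‖Ad (combTransport W M z κ (v + e μ) i * (W ((M : ℤ) • z + v + (i : ℤ) • e κ) μ)⁻¹) X - Ad (combTransport W M z κ v i) X‖
      ≤ 2 * ((((v κ : ℤ) : ℝ) + i + ((d : ℝ) - 1) * ((M : ℝ) - 1)) * a) * ‖X‖ := by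
  set T := combTransport W M z κ v i with hT
  set T' := combTransport W M z κ (v + e μ) i with hT'
  set w := W ((M : ℤ) • z + v + (i : ℤ) • e κ) μ with hw
  have hTu : T ∈ unitaryUnits (Matrix n n ℂ) := combTransport_mem hW M z κ v i
  have hT'u : T' ∈ unitaryUnits (Matrix n n ℂ) := combTransport_mem hW M z κ (v + e μ) i
  have hwu : w ∈ unitaryUnits (Matrix n n ℂ) := hW _ μ
  have hA : T' * w⁻¹ ∈ unitaryUnits (Matrix n n ℂ) := (unitaryUnits _).mul_mem hT'u ((unitaryUnits _).inv_mem hwu)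
  refine norm_Ad_sub_Ad_le_of_le hA hTu X ?_
  -- `T⁻¹ (T' w⁻¹) = T⁻¹ · (T w T'⁻¹)⁻¹ · T`
  have e1 : T⁻¹ * (T' * w⁻¹) = T⁻¹ * (T * w * T'⁻¹)⁻¹ * T := by group
  have hLu : T * w * T'⁻¹ ∈ U1 (Matrix n n ℂ) :=
    mem_U1_of_unitary ((unitaryUnits _).mul_mem ((unitaryUnits _).mul_mem hTu hwu) ((unitaryUnits _).inv_mem hT'u))
  rw [e1, Units.val_mul, Units.val_mul]
  refine (norm_units_inv_conj_sub_one_le (mem_U1_of_unitary hTu) _).trans ?_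
  refine (norm_inv_sub_one_le hLu).trans ?_
  exact norm_combStep_loop_sub_one_le hM hW ha hWa z κ μ hv i

/-! ## §3 The comb block sum of one covariant backward difference telescopes -/

/-- **ONE DIRECTION, ONE κ-OFFSET**: for `‖g‖ ≤ b`, `i < M`, unitary small-field `W`,
`‖Σ_{v∈[0,M)^d} Ad_{comb(v,i)} (cDstar W μ g)(M•z+v+i•e_κ)‖ ≤ 2·M^{d−1}·b + 2(d+1)(M−1)·M^d·a·b` — the block sum is minus the sum over the
transverse `μ`-lines of (far value − near value), each transported to the corner (norm `≤ b`), plus `M^d` thin-loop defects. [folklore] -/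
theorem norm_sum_Ad_combTransport_cDstar_le [Nonempty n] {M : ℕ} (hM : 1 ≤ M) {W : Site d → Fin d → (Matrix n n ℂ)ˣ}
    (hW : IsUnitaryCfg W) {a : ℝ} (ha : 0 ≤ a) (hWa : SmallField W a) (z : Site d) (κ μ : Fin d) {i : ℕ} (hi : i < M)
    (g : Site d → Matrix n n ℂ) {b : ℝ} (hb : ∀ y, ‖g y‖ ≤ b) :
    ‖∑ v ∈ periodBox (d := d) M, Ad (combTransport W M z κ v i) (cDstar W μ g ((M : ℤ) • z + v + (i : ℤ) • e κ))‖
      ≤ 2 * (M : ℝ) ^ (d - 1) * b + 2 * ((d : ℝ) + 1) * ((M : ℝ) - 1) * (M : ℝ) ^ d * a * b := by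
  set q : Site d := (M : ℤ) • z with hq
  -- the transported near value and the defect
  set F : Site d → Matrix n n ℂ := fun v =>
    Ad (combTransport W M z κ v i * (W (q + v + (i : ℤ) • e κ - e μ) μ)⁻¹) (g (q + v + (i : ℤ) • e κ - e μ)) with hF
  set D : Site d → Matrix n n ℂ := fun v =>
    Ad (combTransport W M z κ (v + e μ) i * (W (q + v + (i : ℤ) • e κ) μ)⁻¹) (g (q + v + (i : ℤ) • e κ))
      - Ad (combTransport W M z κ v i) (g (q + v + (i : ℤ) • e κ)) with hD
  have hsplit : ∀ v : Site d,
      Ad (combTransport W M z κ v i) (cDstar W μ g (q + v + (i : ℤ) • e κ)) = -(F (v + e μ) - F v) + D v := by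
    intro v
    have hye : q + (v + e μ) + (i : ℤ) • e κ - e μ = q + v + (i : ℤ) • e κ := by abel
    simp only [hF, hD, cDstar, Ad_sub, Ad_mul, hye]
    abel
  rw [Finset.sum_congr rfl fun v _ => hsplit v, Finset.sum_add_distrib, Finset.sum_neg_distrib, sum_periodBox_telescope M μ F]
  -- sizes
  have hb0 : 0 ≤ b := (norm_nonneg _).trans (hb 0)
  have hFle : ∀ v : Site d, ‖F v‖ ≤ b := by
    intro v
    simp only [hF]
    rw [norm_Ad_of_unitary ((unitaryUnits _).mul_mem (combTransport_mem hW M z κ v i) ((unitaryUnits _).inv_mem (hW _ μ)))]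
    exact hb _
  have hDle : ∀ v ∈ periodBox (d := d) M, ‖D v‖ ≤ 2 * (((d : ℝ) + 1) * ((M : ℝ) - 1) * a) * b := by
    intro v hv
    have h := norm_Ad_combStep_sub_le hM hW ha hWa z κ μ hv i (g (q + v + (i : ℤ) • e κ))
    refine h.trans ?_
    have hvκ : ((v κ : ℤ) : ℝ) ≤ (M : ℝ) - 1 := by
      have := ((mem_periodBox.mp hv) κ).2
      have h' : (v κ : ℤ) + 1 ≤ (M : ℤ) := this
      have h'' : ((v κ : ℤ) : ℝ) + 1 ≤ (M : ℝ) := by exact_mod_cast h'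
      linarith
    have hi' : (i : ℝ) ≤ (M : ℝ) - 1 := by
      have h' : i + 1 ≤ M := hi
      have h'' : ((i + 1 : ℕ) : ℝ) ≤ (M : ℝ) := by exact_mod_cast h'
      push_cast at h''
      linarith
    have hd : (1 : ℝ) ≤ d := by exact_mod_cast Nat.succ_le_of_lt (Fin.pos κ)
    have hM1 : (1 : ℝ) ≤ M := by exact_mod_cast hM
    have hdm : (0 : ℝ) ≤ ((d : ℝ) - 1) * ((M : ℝ) - 1) := mul_nonneg (by linarith) (by linarith)
    have hle : (((v κ : ℤ) : ℝ) + i + ((d : ℝ) - 1) * ((M : ℝ) - 1)) * a ≤ ((d : ℝ) + 1) * ((M : ℝ) - 1) * a := by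
      refine mul_le_mul_of_nonneg_right ?_ ha
      nlinarith
    have hg0 : 0 ≤ ‖g (q + v + (i : ℤ) • e κ)‖ := norm_nonneg _
    have hY0 : 0 ≤ 2 * (((d : ℝ) + 1) * ((M : ℝ) - 1) * a) := by
      have : (0 : ℝ) ≤ ((d : ℝ) + 1) * ((M : ℝ) - 1) := mul_nonneg (by linarith) (by linarith)
      positivity
    calc 2 * ((((v κ : ℤ) : ℝ) + i + ((d : ℝ) - 1) * ((M : ℝ) - 1)) * a) * ‖g (q + v + (i : ℤ) • e κ)‖
        ≤ 2 * (((d : ℝ) + 1) * ((M : ℝ) - 1) * a) * ‖g (q + v + (i : ℤ) • e κ)‖ :=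
          mul_le_mul_of_nonneg_right (by linarith) hg0
      _ ≤ 2 * (((d : ℝ) + 1) * ((M : ℝ) - 1) * a) * b := mul_le_mul_of_nonneg_left (hb _) hY0
  -- the face term
  have hcard : Fintype.card ({j : Fin d // j ≠ μ} → Fin M) = M ^ (d - 1) := by
    rw [Fintype.card_fun, Fintype.card_fin, Fintype.card_subtype_compl, Fintype.card_fin, Fintype.card_unique]
  have hface : ‖∑ r' : {j : Fin d // j ≠ μ} → Fin M, (F (tbase μ r' + (M : ℤ) • e μ) - F (tbase μ r'))‖ ≤ 2 * (M : ℝ) ^ (d - 1) * b := by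
    refine (norm_sum_le _ _).trans ?_
    have h := Finset.sum_le_sum fun (r' : {j : Fin d // j ≠ μ} → Fin M) (_ : r' ∈ univ) =>
      show ‖F (tbase μ r' + (M : ℤ) • e μ) - F (tbase μ r')‖ ≤ 2 * b from
        (norm_sub_le _ _).trans (by linarith [hFle (tbase μ r' + (M : ℤ) • e μ), hFle (tbase μ r')])
    refine h.trans (le_of_eq ?_)
    rw [sum_const, card_univ, hcard, nsmul_eq_mul]
    push_cast
    ring
  -- the defect term
  have hdef : ‖∑ v ∈ periodBox (d := d) M, D v‖ ≤ 2 * ((d : ℝ) + 1) * ((M : ℝ) - 1) * (M : ℝ) ^ d * a * b := by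
    refine (norm_sum_le _ _).trans ((Finset.sum_le_sum hDle).trans (le_of_eq ?_))
    rw [sum_const, card_periodBox, nsmul_eq_mul]
    push_cast
    ring
  calc ‖-∑ r' : {j : Fin d // j ≠ μ} → Fin M, (F (tbase μ r' + (M : ℤ) • e μ) - F (tbase μ r')) + ∑ v ∈ periodBox (d := d) M, D v‖
      ≤ ‖∑ r' : {j : Fin d // j ≠ μ} → Fin M, (F (tbase μ r' + (M : ℤ) • e μ) - F (tbase μ r'))‖ + ‖∑ v ∈ periodBox (d := d) M, D v‖ := by
        refine (norm_add_le _ _).trans ?_; rw [norm_neg]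
    _ ≤ 2 * (M : ℝ) ^ (d - 1) * b + 2 * ((d : ℝ) + 1) * ((M : ℝ) - 1) * (M : ℝ) ^ d * a * b := add_le_add hface hdef

/-! ## §4 The comb line sum of the framed-back tension datum -/

/-- **THE COPY'S OWN BOND CANCELS THE FRAMING**: for the right-trivialised datum `y ν ↦ Ad_{W(y,ν)}⁻¹ T_ν(y)`,
`TWg M (combFrame W M) (Ad_{W}⁻¹ T) z κ = Σ_{v∈[0,M)^d} Σ_{i<M} Ad_{combTransport W M z κ v i} T_κ(M•z+v+i•e_κ)`. [folklore] -/
theorem TWg_combFrame_framed_eq (W : Site d → Fin d → (Matrix n n ℂ)ˣ) (M : ℕ) (T : Site d → Fin d → Matrix n n ℂ) (z : Site d) (κ : Fin d) :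
    TWg M (combFrame W M) (fun y ν => Ad (W y ν)⁻¹ (T y ν)) z κ
      = ∑ v ∈ periodBox (d := d) M, ∑ i ∈ range M, Ad (combTransport W M z κ v i) (T ((M : ℤ) • z + v + (i : ℤ) • e κ) κ) := by
  unfold TWg
  refine Finset.sum_congr rfl fun v _ => Finset.sum_congr rfl fun i _ => ?_
  rw [Ad_combFrame_inv, combTransport_succ, Ad_mul, ← Ad_mul (W _ κ), mul_inv_cancel, Ad_one]

/-- **(β_S) FOR THE COMB LINE SUM — THE COVARIANT DIVERGENCE DATUM IS A BOUNDARY FLUX UP TO THIN LOOPS**: for unitary `W` with `‖W(∂p) − 1‖ ≤ a`,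
any two-index site-framed field `B` with `‖B x μ ν‖ ≤ b`, `M ≥ 1`, the tension `T_ν(y) = Σ_μ cDstar W μ B_{·μν}(y)` satisfies
`‖TWg M (combFrame W M) (y ν ↦ Ad_{W(y,ν)}⁻¹ T_ν(y)) z κ‖ ≤ 2d·M^d·b·(1 + (d+1)(M−1)·M·a)` (against the naive `2d·M^{d+1}·b`). [folklore] -/
theorem norm_TWg_combFrame_tension_le [Nonempty n] {M : ℕ} (hM : 1 ≤ M) {W : Site d → Fin d → (Matrix n n ℂ)ˣ} (hW : IsUnitaryCfg W)
    {a : ℝ} (ha : 0 ≤ a) (hWa : SmallField W a) (B : Site d → Fin d → Fin d → Matrix n n ℂ) {b : ℝ} (hB : ∀ x μ ν, ‖B x μ ν‖ ≤ b)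
    (z : Site d) (κ : Fin d) :
    ‖TWg M (combFrame W M) (fun y ν => Ad (W y ν)⁻¹ (∑ μ : Fin d, cDstar W μ (fun x => B x μ ν) y)) z κ‖
      ≤ 2 * d * (M : ℝ) ^ d * b * (1 + ((d : ℝ) + 1) * ((M : ℝ) - 1) * M * a) := by
  rw [TWg_combFrame_framed_eq]
  -- reorder: `Σ_v Σ_i Ad (Σ_μ …) = Σ_μ Σ_i Σ_v Ad (…)`
  have e1 : ∑ v ∈ periodBox (d := d) M, ∑ i ∈ range M,
        Ad (combTransport W M z κ v i) (∑ μ : Fin d, cDstar W μ (fun x => B x μ κ) ((M : ℤ) • z + v + (i : ℤ) • e κ))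
      = ∑ μ : Fin d, ∑ i ∈ range M, ∑ v ∈ periodBox (d := d) M,
          Ad (combTransport W M z κ v i) (cDstar W μ (fun x => B x μ κ) ((M : ℤ) • z + v + (i : ℤ) • e κ)) := by
    simp only [Ad_sum]
    calc ∑ v ∈ periodBox (d := d) M, ∑ i ∈ range M, ∑ μ : Fin d,
            Ad (combTransport W M z κ v i) (cDstar W μ (fun x => B x μ κ) ((M : ℤ) • z + v + (i : ℤ) • e κ))
        = ∑ v ∈ periodBox (d := d) M, ∑ μ : Fin d, ∑ i ∈ range M,
            Ad (combTransport W M z κ v i) (cDstar W μ (fun x => B x μ κ) ((M : ℤ) • z + v + (i : ℤ) • e κ)) :=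
          Finset.sum_congr rfl fun v _ => Finset.sum_comm
      _ = ∑ μ : Fin d, ∑ v ∈ periodBox (d := d) M, ∑ i ∈ range M,
            Ad (combTransport W M z κ v i) (cDstar W μ (fun x => B x μ κ) ((M : ℤ) • z + v + (i : ℤ) • e κ)) := Finset.sum_comm
      _ = ∑ μ : Fin d, ∑ i ∈ range M, ∑ v ∈ periodBox (d := d) M,
            Ad (combTransport W M z κ v i) (cDstar W μ (fun x => B x μ κ) ((M : ℤ) • z + v + (i : ℤ) • e κ)) :=
          Finset.sum_congr rfl fun μ _ => Finset.sum_comm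
  rw [e1]
  have hd1 : (1 : ℝ) ≤ d := by exact_mod_cast Nat.succ_le_of_lt (Fin.pos κ)
  have hM1 : (1 : ℝ) ≤ M := by exact_mod_cast hM
  have hMd : (M : ℝ) ^ (d - 1) * M = (M : ℝ) ^ d := by
    rw [← pow_succ]
    congr 1
    have := Fin.pos κ
    omega
  have hterm : ∀ μ : Fin d, ∀ i ∈ range M,
      ‖∑ v ∈ periodBox (d := d) M, Ad (combTransport W M z κ v i) (cDstar W μ (fun x => B x μ κ) ((M : ℤ) • z + v + (i : ℤ) • e κ))‖
        ≤ 2 * (M : ℝ) ^ (d - 1) * b + 2 * ((d : ℝ) + 1) * ((M : ℝ) - 1) * (M : ℝ) ^ d * a * b :=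
    fun μ i hi => norm_sum_Ad_combTransport_cDstar_le hM hW ha hWa z κ μ (mem_range.mp hi) (fun x => B x μ κ) (fun y => hB y μ κ)
  calc ‖∑ μ : Fin d, ∑ i ∈ range M, ∑ v ∈ periodBox (d := d) M,
          Ad (combTransport W M z κ v i) (cDstar W μ (fun x => B x μ κ) ((M : ℤ) • z + v + (i : ℤ) • e κ))‖
      ≤ ∑ μ : Fin d, ∑ i ∈ range M, (2 * (M : ℝ) ^ (d - 1) * b + 2 * ((d : ℝ) + 1) * ((M : ℝ) - 1) * (M : ℝ) ^ d * a * b) := by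
        refine (norm_sum_le _ _).trans (Finset.sum_le_sum fun μ _ => ?_)
        exact (norm_sum_le _ _).trans (Finset.sum_le_sum (hterm μ))
    _ = 2 * d * (M : ℝ) ^ d * b * (1 + ((d : ℝ) + 1) * ((M : ℝ) - 1) * M * a) := by
        rw [sum_const, sum_const, card_univ, Fintype.card_fin, card_range, smul_smul, nsmul_eq_mul]
        push_cast
        rw [← hMd]
        ring

/-! ## §5 The ℓ²(torus) form -/

/-- **(β_S) IN THE CURRENCY OF (E3″)**: summed over the coarse period box and the directions,
`Σ_{z∈periodBox N} Σ_κ nhsNormSq (TWg M (combFrame W M) (Ad_W⁻¹ T) z κ) ≤ N^d·d·(2d·M^d·b·(1 + (d+1)(M−1)·M·a))²` — with `λ = M^d(M²+2)∕3`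
(`NE7CombLineSumGramBounds`) and `b ≍ a = ε·M^{−2}` this is `‖ST̃‖²∕λ = O(d³(1+(d+1)ε)²·ε²·N^d·M^{d−6})`, the target order of (H∃)ᵀ. [folklore] -/
theorem sum_nhsNormSq_TWg_combFrame_tension_le [Nonempty n] {M : ℕ} (hM : 1 ≤ M) {W : Site d → Fin d → (Matrix n n ℂ)ˣ}
    (hW : IsUnitaryCfg W) {a : ℝ} (ha : 0 ≤ a) (hWa : SmallField W a) (B : Site d → Fin d → Fin d → Matrix n n ℂ) {b : ℝ}
    (hB : ∀ x μ ν, ‖B x μ ν‖ ≤ b) (N : ℕ) :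
    ∑ z ∈ periodBox (d := d) N, ∑ κ : Fin d,
        nhsNormSq (TWg M (combFrame W M) (fun y ν => Ad (W y ν)⁻¹ (∑ μ : Fin d, cDstar W μ (fun x => B x μ ν) y)) z κ)
      ≤ (N : ℝ) ^ d * d * (2 * d * (M : ℝ) ^ d * b * (1 + ((d : ℝ) + 1) * ((M : ℝ) - 1) * M * a)) ^ 2 := by
  have hpt : ∀ z ∈ periodBox (d := d) N, ∀ κ ∈ (univ : Finset (Fin d)),
      nhsNormSq (TWg M (combFrame W M) (fun y ν => Ad (W y ν)⁻¹ (∑ μ : Fin d, cDstar W μ (fun x => B x μ ν) y)) z κ)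
        ≤ (2 * d * (M : ℝ) ^ d * b * (1 + ((d : ℝ) + 1) * ((M : ℝ) - 1) * M * a)) ^ 2 := by
    intro z _ κ _
    refine (nhsNormSq_le_opNorm_sq _).trans ?_
    exact pow_le_pow_left₀ (norm_nonneg _) (norm_TWg_combFrame_tension_le hM hW ha hWa B hB z κ) 2
  calc ∑ z ∈ periodBox (d := d) N, ∑ κ : Fin d,
          nhsNormSq (TWg M (combFrame W M) (fun y ν => Ad (W y ν)⁻¹ (∑ μ : Fin d, cDstar W μ (fun x => B x μ ν) y)) z κ)
      ≤ ∑ z ∈ periodBox (d := d) N, ∑ κ : Fin d, (2 * d * (M : ℝ) ^ d * b * (1 + ((d : ℝ) + 1) * ((M : ℝ) - 1) * M * a)) ^ 2 :=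
        Finset.sum_le_sum fun z hz => Finset.sum_le_sum fun κ hκ => hpt z hz κ hκ
    _ = (N : ℝ) ^ d * d * (2 * d * (M : ℝ) ^ d * b * (1 + ((d : ℝ) + 1) * ((M : ℝ) - 1) * M * a)) ^ 2 := by
        rw [sum_const, sum_const, card_univ, Fintype.card_fin, card_periodBox, smul_smul, nsmul_eq_mul]
        push_cast
        ring

end

end Summit.QuantumFields.BalabanUV.T4Continuum.NE7CombLineSumDivergence
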